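import Literature.NumberTheory.EllipticCurves.FormalGroupHasseInvariantProofs
import Literature.RingTheory.AdicTopology.PrincipalCompletion
import HarnessLib

/-!
# The Hasse coefficients `w_{2ⁿ−1}` of the chart curve `y² + xy = x³ + a₂x² + a₆` are `≡ 1 (mod 2)` — ordinarity of the universal
# `a₁`-chart at EVERY level (the `p = 2` input of Blakestad–Grant's Thm. 2; step S5′ of the discharge plan for the PRINT stub `stub_sigmaSqTwo`)

Cell `bsd-f1-sign2`, WIDTH-5 attach seat `bsd-line-att-p3` g8 (`--supports stmt-BirchSwinnertonDyer-23008`; plan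
`Cruxes/BSDOfMainConjectureRankOneAtTwo/SIGMASQ-AT-TWO-att-p3.md`, S5′). THEOREMS ONLY; route-independent. BSD is not proved by any of this.
The tree proves `w_{pⁿ−1} ≡ A^{1+p+⋯+pⁿ⁻¹} (mod p)` (`coeff_formalInvDiff_prime_pow_sub_one`, Deuring's `(Ψ₂²)^{(p−1)/2}`) for ODD `p` only, and
`isUnit_coeff_formalInvDiff_prime_pow_sub_one` carries `hp2 : p ≠ 2`. At `p = 2` the Hasse invariant is `a₁`; on the chart (`a₁ = 1`,
`a₃ = a₄ = 0`) in characteristic `2` the invariant differential is EXACTLY `ω = dz/X(z)` (`X = z²x(z)`), `X = E(z²) + z` with `E` even, and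
`[z^{2ⁿ⁺¹−1}](E(z²) + z)⁻¹ = 1` by a halving induction (`(E + z)⁻¹ = (E + z)·(E² + z²)⁻¹`, `E² + z² = g(z²)` of the same shape).

* `coeff_invOfUnit_expand_add_X` — in characteristic `2`: `[z^{2ⁿ⁺¹−1}] (e(z²) + z)⁻¹ = 1` for every `e` with `e(0) = 1`;
* `formalXMulSq_mul_formalInvDiff_eq_one_charTwo` — on the chart in characteristic `2`: `X·W = 1` (`ω = dz/X`);
* `coeff_formalInvDiff_two_pow_sub_one_charTwo` — on the chart in characteristic `2`: `w_{2ⁿ⁺¹−1} = 1`;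
* `coeff_formalInvDiff_two_pow_sub_one_sub_one_mem` — over ANY commutative ring, chart curve `⟨1, a₂, 0, 0, a₆⟩`: `w_{2ⁿ⁺¹−1} − 1 ∈ (2)`;
* `isUnit_coeff_formalInvDiff_two_pow_sub_one` — over a `2`-adically complete ring (e.g. `R̂₂`): all `w_{2ⁿ⁺¹−1}` are UNITS — the hypothesis
  `hw` of a `p = 2` version of `exists_padicWeierstrassZetaConst`.

## Sources
* N. M. Katz, *p-adic properties of modular schemes and modular forms*, LNM 350 (1973), §2.0–2.1 (Hasse invariant and the expansion of
  `ω`); C. Blakestad, D. Grant, J. Number Theory 249 (2023), Prop. 3, Lemma 4. [cite: BlakestadGrant2023, Lemma 4]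
* J. H. Silverman, *AEC* 2nd ed., IV.1, V.4, Appendix A Prop. 1.1. [cite: SilvermanAEC2009, Appendix A Prop. 1.1]
-/

noncomputable section

set_option linter.dupNamespace false
set_option autoImplicit false

open PowerSeries

namespace Summit.BirchSwinnertonDyer.BirchSwinnertonDyer.Theorems.AlignedTransportAtTwoSigmaSqTwo

section CharTwo

variable {S : Type*} [CommRing S] [CharP S 2]

/-- In characteristic `2`: `(f + g)² = f² + g²`. [folklore] -/
theorem add_sq_charTwo (f g : S⟦X⟧) : (f + g) ^ 2 = f ^ 2 + g ^ 2 := by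
  have h2 : (2 : S⟦X⟧) = 0 := by
    rw [show (2 : S⟦X⟧) = C (2 : S) from (map_ofNat C 2).symm, CharTwo.two_eq_zero, map_zero]
  linear_combination (f * g) * h2

/-- In characteristic `2` a square is an expansion: `f² = expand₂(Frob f)`. [folklore] -/
theorem sq_eq_expand (f : S⟦X⟧) : f ^ 2 = expand 2 two_ne_zero (PowerSeries.map (frobenius S 2) f) := by
  rw [← PowerSeries.map_expand]
  exact (MvPowerSeries.map_frobenius_expand 2 two_ne_zero).symm

omit [CharP S 2] in
/-- Odd coefficients of an expansion vanish. [folklore] -/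
theorem coeff_expand_two_odd (e : S⟦X⟧) (k : ℕ) : coeff (2 * k + 1) (expand 2 two_ne_zero e) = 0 :=
  coeff_expand_of_not_dvd 2 two_ne_zero e (by omega)

/-- In characteristic `2` an expansion has zero derivative. [folklore] -/
theorem derivative_expand_two (e : S⟦X⟧) : d⁄dX S (expand 2 two_ne_zero e) = 0 := by
  ext k
  rw [coeff_derivative, map_zero]
  rcases Nat.even_or_odd (k + 1) with ⟨j, hj⟩ | ⟨j, hj⟩
  · have hk : ((k : S) + 1) = 0 := by
      have : ((k + 1 : ℕ) : S) = 0 := by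
        rw [hj, ← two_mul, Nat.cast_mul, CharP.cast_eq_zero S 2, zero_mul]
      exact_mod_cast this
    rw [hk, mul_zero]
  · rw [hj, coeff_expand_two_odd, zero_mul]

/-- **Structure of the inverse**: in characteristic `2`, for `u = expand₂ e + z` (`e(0) = 1`): `u⁻¹ = u · expand₂(g⁻¹)` with
`g = expand₂(Frob e) + z` (since `u² = expand₂ g`). [cite: BlakestadGrant2023, Lemma 4] -/
theorem invOfUnit_expand_add_X_eq (e : S⟦X⟧) (he : constantCoeff e = 1) :
    invOfUnit (expand 2 two_ne_zero e + X) 1 =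
      (expand 2 two_ne_zero e + X) *
        expand 2 two_ne_zero (invOfUnit (expand 2 two_ne_zero (PowerSeries.map (frobenius S 2) e) + X) 1) := by
  set u := expand 2 two_ne_zero e + X with hu
  have hu0 : constantCoeff u = 1 := by rw [hu, map_add, constantCoeff_expand, he, constantCoeff_X, add_zero]
  set e' := PowerSeries.map (frobenius S 2) e with he'
  have he'0 : constantCoeff e' = 1 := by
    rw [he', ← coeff_zero_eq_constantCoeff_apply, coeff_map, coeff_zero_eq_constantCoeff_apply, he, map_one]
  set g := expand 2 two_ne_zero e' + X with hg
  have hg0 : constantCoeff g = 1 := by rw [hg, map_add, constantCoeff_expand, he'0, constantCoeff_X, add_zero]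
  have husq : u ^ 2 = expand 2 two_ne_zero g := by
    rw [hu, add_sq_charTwo, hg, map_add, expand_X, ← map_pow, sq_eq_expand]
  set gi := invOfUnit g 1 with hgi
  have hggi : g * gi = 1 := mul_invOfUnit g 1 (by rw [hg0, Units.val_one])
  have huui : u * invOfUnit u 1 = 1 := mul_invOfUnit u 1 (by rw [hu0, Units.val_one])
  have hv : u * (u * expand 2 two_ne_zero gi) = 1 := by
    rw [← mul_assoc, ← sq, husq, ← map_mul, hggi, map_one]
  calc invOfUnit u 1 = invOfUnit u 1 * (u * (u * expand 2 two_ne_zero gi)) := by rw [hv, mul_one]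
    _ = (u * invOfUnit u 1) * (u * expand 2 two_ne_zero gi) := by ring
    _ = u * expand 2 two_ne_zero gi := by rw [huui, one_mul]

/-- **Halving induction**: in characteristic `2`, for every `e` with `e(0) = 1`: `[z^{2ⁿ⁺¹−1}] (expand₂ e + z)⁻¹ = 1`
(the odd part of `u⁻¹ = u·expand₂(g⁻¹)` is `z·expand₂(g⁻¹)`, so `[z^{2k+1}]u⁻¹ = [z^k]g⁻¹`, and `g` has the same shape).
[cite: BlakestadGrant2023, Lemma 4] -/
theorem coeff_invOfUnit_expand_add_X : ∀ (n : ℕ) (e : S⟦X⟧), constantCoeff e = 1 →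
    coeff (2 ^ (n + 1) - 1) (invOfUnit (expand 2 two_ne_zero e + X) 1) = 1 := by
  intro n
  induction n with
  | zero =>
    intro e he
    rw [invOfUnit_expand_add_X_eq e he, add_mul, map_add, ← map_mul, show 2 ^ (0 + 1) - 1 = 2 * 0 + 1 from rfl,
      coeff_expand_two_odd, zero_add, coeff_succ_X_mul, mul_zero, coeff_zero_eq_constantCoeff, constantCoeff_expand,
      constantCoeff_invOfUnit, inv_one, Units.val_one]
  | succ n ih =>
    intro e he
    have hidx : 2 ^ (n + 1 + 1) - 1 = 2 * (2 ^ (n + 1) - 1) + 1 := by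
      have : 1 ≤ 2 ^ (n + 1) := Nat.one_le_two_pow
      omega
    have he' : constantCoeff (PowerSeries.map (frobenius S 2) e) = 1 := by
      rw [← coeff_zero_eq_constantCoeff_apply, coeff_map, coeff_zero_eq_constantCoeff_apply, he, map_one]
    rw [invOfUnit_expand_add_X_eq e he, add_mul, map_add, ← map_mul, hidx, coeff_expand_two_odd, zero_add,
      coeff_succ_X_mul, coeff_expand_mul]
    exact ih _ he'

end CharTwo

/-! ## The chart curve in characteristic `2`: `ω = dz/X` -/

section Chart

variable {S : Type*} [CommRing S] [CharP S 2] (V : WeierstrassCurve S)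

/-- On the chart (`a₁ = 1`, `a₃ = a₄ = 0`) in characteristic `2`: **`X·W = 1`**, i.e. `ω = dz/X(z)` — from `Ỹ·W = zX' − 2X`
(`Ỹ = (a₁z − 2)X + a₃z³ = zX`) and `X' = 1` (`X = 1 + z + a₂z² + a₆z⁶X⁻²` has odd part `z`). [cite: SilvermanAEC2009, IV.1] -/
theorem formalXMulSq_mul_formalInvDiff_eq_one_charTwo (h1 : V.a₁ = 1) (h3 : V.a₃ = 0) (h4 : V.a₄ = 0) :
    V.formalXMulSq * V.formalInvDiff = 1 := by
  have h2S : (2 : S⟦X⟧) = 0 := by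
    rw [show (2 : S⟦X⟧) = C (2 : S) from (map_ofNat C 2).symm, CharTwo.two_eq_zero, map_zero]
  set Xs := V.formalXMulSq with hXs
  -- `Xs = expand₂ e + X`
  have hXs0 : constantCoeff Xs = 1 := V.constantCoeff_formalXMulSq
  set xi := invOfUnit Xs 1 with hxi
  have hxxi : Xs * xi = 1 := mul_invOfUnit Xs 1 (by rw [hXs0, Units.val_one])
  have hsq := V.formalXMulSq_sq_eq
  rw [← hXs, h1, h3, h4, map_one, one_mul, map_zero, zero_mul, zero_mul, add_zero] at hsq
  -- `Xs = 1 + X + a₂X² + a₆X⁶xi²`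
  have hXs_eq : Xs = 1 + X + C V.a₂ * X ^ 2 + C V.a₆ * X ^ 6 * xi ^ 2 := by
    have e1 : Xs ^ 2 * (Xs + X + C V.a₂ * X ^ 2 + C V.a₆ * X ^ 6 * xi ^ 2 - 1) = 0 := by
      linear_combination (-1 : S⟦X⟧) * hsq + (C V.a₆ * X ^ 6 * (Xs * xi + 1)) * hxxi
    have hne : IsUnit (Xs ^ 2) := by
      rw [PowerSeries.isUnit_iff_constantCoeff, map_pow, hXs0, one_pow]; exact isUnit_one
    have e2 := hne.mul_right_eq_zero.mp e1
    linear_combination e2 - (X + C V.a₂ * X ^ 2 + C V.a₆ * X ^ 6 * xi ^ 2) * h2S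
  -- the derivative of `Xs` is `1`
  have hder : d⁄dX S Xs = 1 := by
    have hev : d⁄dX S (1 + C V.a₂ * X ^ 2 + C V.a₆ * X ^ 6 * xi ^ 2) = 0 := by
      have hexp : 1 + C V.a₂ * X ^ 2 + C V.a₆ * X ^ 6 * xi ^ 2 =
          expand 2 two_ne_zero (1 + C V.a₂ * X + C V.a₆ * X ^ 3 * PowerSeries.map (frobenius S 2) xi) := by
        rw [map_add, map_add, map_one, map_mul, map_mul, map_mul, expand_C, expand_C, expand_X, map_pow, expand_X,
          ← sq_eq_expand]
        ring
      rw [hexp]; exact derivative_expand_two _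
    have e : Xs = X + (1 + C V.a₂ * X ^ 2 + C V.a₆ * X ^ 6 * xi ^ 2) := by rw [hXs_eq]; ring
    rw [e, map_add, hev, add_zero, PowerSeries.derivative_X]
  -- `Ỹ·W = X·Xs' − 2Xs` with `Ỹ = X·Xs`
  have h := V.formalYTilde_mul_formalInvDiff
  rw [WeierstrassCurve.formalYTilde_def, ← hXs, h1, h3, map_one, map_zero, zero_mul, add_zero, hder, mul_one] at h
  -- `(X − 2)·Xs·W = X − 2Xs`: cancel `X` using `2 = 0`
  have h' : X * (Xs * V.formalInvDiff) = X * 1 := by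
    linear_combination h + (Xs * V.formalInvDiff - Xs) * h2S
  exact PowerSeries.X_mul_cancel h'

/-- **`w_{2ⁿ⁺¹−1} = 1` on the chart in characteristic `2`.** [cite: BlakestadGrant2023, Lemma 4] -/
theorem coeff_formalInvDiff_two_pow_sub_one_charTwo (h1 : V.a₁ = 1) (h3 : V.a₃ = 0) (h4 : V.a₄ = 0) (n : ℕ) :
    coeff (2 ^ (n + 1) - 1) V.formalInvDiff = 1 := by
  have h2S : (2 : S⟦X⟧) = 0 := by
    rw [show (2 : S⟦X⟧) = C (2 : S) from (map_ofNat C 2).symm, CharTwo.two_eq_zero, map_zero]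
  set Xs := V.formalXMulSq with hXs
  have hXs0 : constantCoeff Xs = 1 := V.constantCoeff_formalXMulSq
  set xi := invOfUnit Xs 1 with hxi
  have hxxi : Xs * xi = 1 := mul_invOfUnit Xs 1 (by rw [hXs0, Units.val_one])
  have hW : V.formalInvDiff = xi := by
    have h := formalXMulSq_mul_formalInvDiff_eq_one_charTwo V h1 h3 h4
    rw [← hXs] at h
    calc V.formalInvDiff = V.formalInvDiff * (Xs * xi) := by rw [hxxi, mul_one]
      _ = (Xs * V.formalInvDiff) * xi := by ring
      _ = xi := by rw [h, one_mul]
  have hsq := V.formalXMulSq_sq_eq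
  rw [← hXs, h1, h3, h4, map_one, one_mul, map_zero, zero_mul, zero_mul, add_zero] at hsq
  have hXs_eq : Xs = 1 + X + C V.a₂ * X ^ 2 + C V.a₆ * X ^ 6 * xi ^ 2 := by
    have e1 : Xs ^ 2 * (Xs + X + C V.a₂ * X ^ 2 + C V.a₆ * X ^ 6 * xi ^ 2 - 1) = 0 := by
      linear_combination (-1 : S⟦X⟧) * hsq + (C V.a₆ * X ^ 6 * (Xs * xi + 1)) * hxxi
    have hne : IsUnit (Xs ^ 2) := by
      rw [PowerSeries.isUnit_iff_constantCoeff, map_pow, hXs0, one_pow]; exact isUnit_one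
    have e2 := hne.mul_right_eq_zero.mp e1
    linear_combination e2 - (X + C V.a₂ * X ^ 2 + C V.a₆ * X ^ 6 * xi ^ 2) * h2S
  set e : S⟦X⟧ := 1 + C V.a₂ * X + C V.a₆ * X ^ 3 * PowerSeries.map (frobenius S 2) xi with hedef
  have hexp : Xs = expand 2 two_ne_zero e + X := by
    rw [hXs_eq, hedef, map_add, map_add, map_one, map_mul, map_mul, map_mul, expand_C, expand_C, expand_X, map_pow,
      expand_X, ← sq_eq_expand]
    ring
  have he0 : constantCoeff e = 1 := by
    rw [hedef, map_add, map_add, map_one, map_mul, constantCoeff_C, constantCoeff_X, mul_zero, add_zero, map_mul, map_mul,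
      map_pow, constantCoeff_X, zero_pow three_ne_zero, mul_zero, zero_mul, add_zero]
  rw [hW, hxi]
  have : invOfUnit Xs 1 = invOfUnit (expand 2 two_ne_zero e + X) 1 := by rw [← hexp]
  rw [this]
  exact coeff_invOfUnit_expand_add_X n e he0

end Chart

/-! ## Any ring: `w_{2ⁿ⁺¹−1} ≡ 1 (mod 2)` on the chart, and units in a `2`-adically complete ring -/

section AnyRing

variable {R : Type*} [CommRing R]

/-- **`w_{2ⁿ⁺¹−1} − 1 ∈ (2)`** for the chart curve `y² + xy = x³ + a₂x² + a₆` over ANY commutative ring (reduce modulo `2`).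
[cite: BlakestadGrant2023, Lemma 4] -/
theorem coeff_formalInvDiff_two_pow_sub_one_sub_one_mem (a₂ a₆ : R) (n : ℕ) :
    coeff (2 ^ (n + 1) - 1) (⟨1, a₂, 0, 0, a₆⟩ : WeierstrassCurve R).formalInvDiff - 1 ∈ Ideal.span {(2 : R)} := by
  set I : Ideal R := Ideal.span {(2 : R)} with hI
  rw [← Ideal.Quotient.eq_zero_iff_mem, map_sub, map_one, sub_eq_zero]
  by_cases htriv : Subsingleton (R ⧸ I)
  · exact Subsingleton.elim _ _
  · haveI : Nontrivial (R ⧸ I) := not_subsingleton_iff_nontrivial.mp htriv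
    have h2 : (2 : R ⧸ I) = 0 := by
      rw [show (2 : R ⧸ I) = Ideal.Quotient.mk I 2 from (map_ofNat _ 2).symm, Ideal.Quotient.eq_zero_iff_mem]
      exact Ideal.mem_span_singleton_self _
    haveI : CharP (R ⧸ I) 2 := CharTwo.of_one_ne_zero_of_two_eq_zero one_ne_zero h2
    have hmap : Ideal.Quotient.mk I (coeff (2 ^ (n + 1) - 1) (⟨1, a₂, 0, 0, a₆⟩ : WeierstrassCurve R).formalInvDiff) =
        coeff (2 ^ (n + 1) - 1) (((⟨1, a₂, 0, 0, a₆⟩ : WeierstrassCurve R).map (Ideal.Quotient.mk I)).formalInvDiff) := by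
      rw [← WeierstrassCurve.map_formalInvDiff, coeff_map]
    rw [hmap]
    exact coeff_formalInvDiff_two_pow_sub_one_charTwo _ (by simp [WeierstrassCurve.map]) (by simp [WeierstrassCurve.map])
      (by simp [WeierstrassCurve.map]) n

/-- **All Hasse coefficients `w_{2ⁿ⁺¹−1}` of the chart curve are UNITS in a `2`-adically complete ring** (e.g. the universal
`a₁`-chart ring `R̂₂`): the ordinarity hypothesis `hw` of Blakestad–Grant's Thm. 2 at every level, at `p = 2`. [cite: BlakestadGrant2023, Prop. 3] -/
theorem isUnit_coeff_formalInvDiff_two_pow_sub_one [IsAdicComplete (Ideal.span {(2 : R)}) R] (a₂ a₆ : R) (n : ℕ) :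
    IsUnit (coeff (2 ^ (n + 1) - 1) (⟨1, a₂, 0, 0, a₆⟩ : WeierstrassCurve R).formalInvDiff) := by
  refine Literature.RingTheory.AdicTopology.isUnit_of_isUnit_mk (Ideal.span {(2 : R)}) ?_
  have e : Ideal.Quotient.mk (Ideal.span {(2 : R)}) (coeff (2 ^ (n + 1) - 1) (⟨1, a₂, 0, 0, a₆⟩ : WeierstrassCurve R).formalInvDiff) =
      Ideal.Quotient.mk (Ideal.span {(2 : R)}) 1 := by
    rw [Ideal.Quotient.eq]; exact coeff_formalInvDiff_two_pow_sub_one_sub_one_mem a₂ a₆ n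
  rw [e, map_one]; exact isUnit_one

end AnyRing

end Summit.BirchSwinnertonDyer.BirchSwinnertonDyer.Theorems.AlignedTransportAtTwoSigmaSqTwo
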